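import Literature.Probability.Percolation.KozmaNitzanThm4Witness
import HarnessLib

/-!
# `NoHeavyLowerTail` (stmt-CriticalPhenomena-4575) — Kozma–Nitzan's Questions 7/9 for ONE-LAYER observers:
# Theorem 4 with the comparison relay ranked IN THE GRAPH ITSELF

Support file (hull-port / coupling seat `prim-hp-1` gen 7; `--supports stmt-CriticalPhenomena-4575`).
No definitions, no named facts, no sorries.

Kozma–Nitzan (arXiv:2401.12397) prove Theorem 4 (p. 12): a one-layer observer `0` (isolated in `G ∖ A`) is
"good", with the comparison relay `a₀ = argmin_A P_{G∖{0}}(· ↔ b)` ranked in the vertex-deleted graph; the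
tree records the witness form `KozmaNitzan2024_thm4_witness` (any `a₀` at most as connected to `b` OFF `0` as
every port of `0`).  Their Questions 7 and 9 (p. 36) ask whether the minimiser in `G` itself, resp. in the
graph with the edges at `0` removed, also satisfies the pre-FKG inequality (41) `P(0 ↔ b, 0 ↔ A) ≥ P(0 ↔ A, a ↔ b)`.

* `oneLayer_preFKG_of_dominated_inG` — for a ONE-LAYER observer the answer is YES in the following witness
  form: if `a ≠ 0` is at most as connected to `b` IN `G` as every port of `0`
  (`P_G(a ↔ b) ≤ P_G(p ↔ b)` for every `p ∈ A` with `w s(0,p) ≠ 0`), then `P(a ↔ b, 0 ↔ A) ≤ P(0 ↔ b, 0 ↔ A)`.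
  Proof (three lines on top of Theorem 4): let `v⋆` be a port minimising `P_{G∖{0}}(· ↔ b)` among the ports.
  If `P_{G∖{0}}(a ↔ b) ≤ P_{G∖{0}}(v⋆ ↔ b)`, `a` is a Theorem-4 witness.  Otherwise `v⋆` is a Theorem-4 witness,
  and `P(a ↔ b, 0 ↔ A) = P(a ↔ b) − P(σ_∅)·P_{G∖{0}}(a ↔ b) ≤ P(v⋆ ↔ b) − P(σ_∅)·P_{G∖{0}}(v⋆ ↔ b) = P(v⋆ ↔ b, 0 ↔ A)`
  (`σ_∅` = all pairs at `0` closed, independent of the pairs off `0`; on `σ_∅` an open `a–b` path avoids `0`).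
* `real_openConn_inter_reach_eq` — the bookkeeping identity `P(x ↔ b, 0 ↔ A) = P(x ↔ b) − P(σ_∅)·P_{G∖{0}}(x ↔ b)`
  for a one-layer `0` and `x, b ≠ 0`.

Role in the cell (memo HULLPORT-COUPLING.md §48): this is the `m = 1` (single group) case of the split-ranking
conjecture (★) — Question 9 for observers of depth two — whose other extreme (`m` = number of ports) is
Theorem 4 itself.
-/

namespace Summit.CriticalPhenomena.PercolationContinuityZ3.Theorems

open MeasureTheory Set
open Literature.Probability.LatticeModels (prodBernoulli)
open Literature.Probability.Percolation
open Literature.Probability.Percolation.KNPreFKG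

noncomputable section
open Classical

variable {V : Type*} [Fintype V]

/-- **Bookkeeping for a one-layer observer.**  If every pair `s(0,u)` with `u ∉ A`, `u ≠ 0` has weight `0`,
`0 ∉ A`, and `x, b ≠ 0`, then `P(x ↔ b, 0 ↔ A) = P(x ↔ b) − P(σ_∅) · P_{G∖{0}}(x ↔ b)`: decompose `P(x ↔ b)` and
`P(x ↔ b, 0 ↔ A)` along the stars `σ_B`, `B ⊆ A`; the two sums agree for `B ≠ ∅` (a star with a port lies in
`{0 ↔ A}`, a portless nonempty star is null) and for `B = ∅` the second vanishes while the first is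
`P(σ_∅ ∩ {x ↔ b off 0}) = P(σ_∅)·P_{G∖{0}}(x ↔ b)`. [cite: KozmaNitzan2024, proof of Thm. 4 (pp. 13–14)] -/
theorem real_openConn_inter_reach_eq (w : Sym2 V → unitInterval) (A : Finset V) (o b x : V)
    (hoA : o ∉ A) (hxo : x ≠ o) (hbo : b ≠ o)
    (hiso : ∀ u, u ≠ o → u ∉ A → w s(o, u) = 0) :
    (prodBernoulli w).real (openConn x b ∩ ⋃ a' ∈ A, openConn o a') =
      (prodBernoulli w).real (openConn x b) -
        (prodBernoulli w).real (starEvent o (∅ : Set V)) *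
          (prodBernoulli w).real (openConnIn ({o}ᶜ : Set V) x b) := by
  classical
  set U : Set (BondConfig V) := ⋃ a' ∈ A, openConn o a' with hU
  -- both sides along the stars of `0`
  rw [real_eq_sum_inter_starEvent w A o hoA hiso (openConn x b ∩ U),
    real_eq_sum_inter_starEvent w A o hoA hiso (openConn x b)]
  -- single out the `B = ∅` terms
  have h0mem : (∅ : Finset V) ∈ A.powerset := Finset.mem_powerset.2 (Finset.empty_subset A)
  rw [← Finset.add_sum_erase _ _ h0mem, ← Finset.add_sum_erase _ _ h0mem]
  -- the `B = ∅` term of the left sum vanishes: under `σ_∅`, `0 ↮ A`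
  have hL0 : (prodBernoulli w).real ((openConn x b ∩ U) ∩ starEvent o ↑(∅ : Finset V)) = 0 := by
    have h0 : (openConn x b ∩ U) ∩ starEvent o ↑(∅ : Finset V) = (∅ : Set (BondConfig V)) := by
      ext ω
      simp only [hU, mem_inter_iff, mem_iUnion, exists_prop, mem_empty_iff_false, iff_false, not_and]
      rintro ⟨-, a', ha', hoa'⟩ hσ
      rw [Finset.coe_empty] at hσ
      exact not_reachable_of_mem_starEvent_empty hσ (fun h => hoA (h ▸ ha')) hoa'
    rw [h0, measureReal_empty]
  -- the `B = ∅` term of the right sum: independence of `σ_∅` from the pairs off `0`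
  have hR0 : (prodBernoulli w).real (openConn x b ∩ starEvent o ↑(∅ : Finset V)) =
      (prodBernoulli w).real (starEvent o (∅ : Set V)) *
        (prodBernoulli w).real (openConnIn ({o}ᶜ : Set V) x b) := by
    have hxS : x ∈ ({o}ᶜ : Set V) := mem_compl_singleton_iff.2 hxo
    have hbS : b ∈ ({o}ᶜ : Set V) := mem_compl_singleton_iff.2 hbo
    -- on `σ_∅` an open `x–b` path avoids `0`
    have hset : (openConn x b : Set (BondConfig V)) ∩ starEvent o ↑(∅ : Finset V) =
        starEvent o (∅ : Set V) ∩
          restrictConfig (Subtype.val : ({o}ᶜ : Set V) → V) ⁻¹' (openConn (⟨x, hxS⟩ : ({o}ᶜ : Set V)) ⟨b, hbS⟩) := by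
      rw [preimage_openConn_val, Finset.coe_empty]
      ext ω
      constructor
      · rintro ⟨hxb, hσ⟩
        refine ⟨hσ, ?_⟩
        obtain ⟨p⟩ := (hxb : (openGraph ω).Reachable x b)
        rcases (walk_decomp hσ p hbo).1 hxo with h | ⟨⟨u, huB, -, -⟩, -⟩
        · exact h
        · exact absurd huB (Set.notMem_empty u)
      · rintro ⟨hσ, h⟩
        exact ⟨reachable_of_openConnIn h, hσ⟩
    rw [hset, real_starEvent_inter_preimage, preimage_openConn_val]
  -- the `B ≠ ∅` terms agree
  have hrest : ∀ B ∈ A.powerset.erase ∅,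
      (prodBernoulli w).real ((openConn x b ∩ U) ∩ starEvent o ↑B) =
        (prodBernoulli w).real (openConn x b ∩ starEvent o ↑B) := by
    intro B hB
    have hBne : B ≠ ∅ := (Finset.mem_erase.1 hB).1
    have hBA : B ⊆ A := Finset.mem_powerset.1 (Finset.mem_erase.1 hB).2
    by_cases hport : ∃ v ∈ B, w s(o, v) ≠ 0
    · obtain ⟨v, hv, -⟩ := hport
      have hvo : v ≠ o := fun h => hoA (h ▸ hBA hv)
      have hσU : starEvent o (↑B : Set V) ⊆ U := by
        intro ω hσ
        have hov : s(o, v) ∈ ω := ((mem_starEvent_iff o (↑B) ω).1 hσ v hvo).2 (Finset.mem_coe.2 hv)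
        have hadj : (openGraph ω).Adj o v := (openGraph_adj ω o v).2 ⟨hov, hvo.symm⟩
        exact mem_iUnion₂.2 ⟨v, hBA hv, hadj.reachable⟩
      congr 1
      ext ω
      exact ⟨fun ⟨⟨h1, _⟩, h2⟩ => ⟨h1, h2⟩, fun ⟨h1, h2⟩ => ⟨⟨h1, hσU h2⟩, h2⟩⟩
    · push Not at hport
      obtain ⟨v, hv⟩ := Finset.nonempty_iff_ne_empty.2 hBne
      have hvo : v ≠ o := fun h => hoA (h ▸ hBA hv)
      have hnull : (prodBernoulli w).real (starEvent o (↑B : Set V)) = 0 := by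
        refine le_antisymm ?_ measureReal_nonneg
        calc (prodBernoulli w).real (starEvent o (↑B : Set V))
            ≤ (prodBernoulli w).real {ω : BondConfig V | s(o, v) ∈ ω} := measureReal_mono fun ω hσ =>
                ((mem_starEvent_iff o (↑B) ω).1 hσ v hvo).2 (Finset.mem_coe.2 hv)
          _ = 0 := by
                rw [Literature.Probability.LatticeModels.prodBernoulli_real_setOf_mem, hport v hv]
                rfl
      have h1 : (prodBernoulli w).real ((openConn x b ∩ U) ∩ starEvent o ↑B) = 0 :=
        le_antisymm ((measureReal_mono inter_subset_right).trans hnull.le) measureReal_nonneg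
      have h2 : (prodBernoulli w).real (openConn x b ∩ starEvent o ↑B) = 0 :=
        le_antisymm ((measureReal_mono inter_subset_right).trans hnull.le) measureReal_nonneg
      rw [h1, h2]
  rw [Finset.sum_congr rfl hrest, hL0, hR0]
  ring

/-- **Kozma–Nitzan's Questions 7/9 for a one-layer observer (witness form).**  Let `0 ∉ A` be isolated in
`G ∖ A` and let `a ≠ 0` be ANY vertex at most as connected to `b` IN `G` as every port of `0`
(`P_G(a ↔ b) ≤ P_G(p ↔ b)` for all `p ∈ A` with `w s(0,p) ≠ 0`).  Then the pre-FKG inequality (41) holds at `a`: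
`P(a ↔ b, 0 ↔ A) ≤ P(0 ↔ b, 0 ↔ A)`.  (Theorem 4 asks the domination in `G ∖ {0}` instead; for a general
observer Questions 7/9 are open.)  Proof: with `v⋆` a port minimising `P_{G∖{0}}(· ↔ b)` among the ports, either
`a` is a Theorem-4 witness, or `v⋆` is one and `P(a ↔ b, 0 ↔ A) ≤ P(v⋆ ↔ b, 0 ↔ A)` by
`real_openConn_inter_reach_eq`. [cite: KozmaNitzan2024, Thm. 4 (pp. 12–14), Questions 7 and 9 (p. 36)] -/
theorem oneLayer_preFKG_of_dominated_inG (w : Sym2 V → unitInterval) (A : Finset V)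
    (o b a : V) (hoA : o ∉ A) (hao : a ≠ o)
    (hiso : ∀ u, u ≠ o → u ∉ A → w s(o, u) = 0)
    (hdomG : ∀ p ∈ A, w s(o, p) ≠ 0 →
      (prodBernoulli w).real (openConn a b) ≤ (prodBernoulli w).real (openConn p b)) :
    (prodBernoulli w).real (openConn a b ∩ ⋃ a' ∈ A, openConn o a') ≤
      (prodBernoulli w).real (openConn o b ∩ ⋃ a' ∈ A, openConn o a') := by
  classical
  set μ := prodBernoulli w with hμ
  -- degenerate case `b = 0`
  by_cases hbo : b = o
  · subst hbo
    refine measureReal_mono ?_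
    rintro ω ⟨-, hU⟩
    exact ⟨(SimpleGraph.Reachable.refl b : (openGraph ω).Reachable b b), hU⟩
  -- the ports of `0`
  set P : Finset V := A.filter fun p => w s(o, p) ≠ 0 with hP
  rcases P.eq_empty_or_nonempty with hPe | hPne
  · -- no port: `a` is vacuously a Theorem-4 witness
    refine KozmaNitzan2024_thm4_witness w A o b a hoA hao hiso fun p hp hwp => ?_
    have : p ∈ P := Finset.mem_filter.2 ⟨hp, hwp⟩
    rw [hPe] at this
    exact absurd this (Finset.notMem_empty p)
  · -- `v⋆`: a port minimising the off-`0` connection probability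
    obtain ⟨v, hvP, hvmin⟩ := P.exists_min_image
      (fun p => μ.real (openConnIn ({o}ᶜ : Set V) p b)) hPne
    have hvA : v ∈ A := (Finset.mem_filter.1 hvP).1
    have hwv : w s(o, v) ≠ 0 := (Finset.mem_filter.1 hvP).2
    have hvo : v ≠ o := fun h => hoA (h ▸ hvA)
    by_cases hav : μ.real (openConnIn ({o}ᶜ : Set V) a b) ≤ μ.real (openConnIn ({o}ᶜ : Set V) v b)
    · -- `a` itself is a Theorem-4 witness
      exact KozmaNitzan2024_thm4_witness w A o b a hoA hao hiso fun p hp hwp =>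
        hav.trans (hvmin p (Finset.mem_filter.2 ⟨hp, hwp⟩))
    · -- `v⋆` is a Theorem-4 witness, and `a` transfers to it
      push Not at hav
      have T4 := KozmaNitzan2024_thm4_witness w A o b v hoA hvo hiso fun p hp hwp =>
        hvmin p (Finset.mem_filter.2 ⟨hp, hwp⟩)
      refine le_trans ?_ T4
      rw [real_openConn_inter_reach_eq w A o b a hoA hao hbo hiso,
        real_openConn_inter_reach_eq w A o b v hoA hvo hbo hiso]
      have h1 : μ.real (openConn a b) ≤ μ.real (openConn v b) := hdomG v hvA hwv
      have h2 : μ.real (starEvent o (∅ : Set V)) * μ.real (openConnIn ({o}ᶜ : Set V) v b) ≤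
          μ.real (starEvent o (∅ : Set V)) * μ.real (openConnIn ({o}ᶜ : Set V) a b) :=
        mul_le_mul_of_nonneg_left hav.le measureReal_nonneg
      linarith

/-- **Corollary ((2)-form and additive gluing with constant one).**  Under the hypotheses of
`oneLayer_preFKG_of_dominated_inG`: `P(a ↔ b, 0 ↔ A) ≤ P(0 ↔ b)`, hence
`P(0 ↔ A) − P(0 ↔ b) ≤ P(a ↮ b)`. [cite: KozmaNitzan2024, inequalities (2), (3) (p. 3); Thm. 4 (p. 12)] -/
theorem oneLayer_gluing_of_dominated_inG (w : Sym2 V → unitInterval) (A : Finset V)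
    (o b a : V) (hoA : o ∉ A) (hao : a ≠ o)
    (hiso : ∀ u, u ≠ o → u ∉ A → w s(o, u) = 0)
    (hdomG : ∀ p ∈ A, w s(o, p) ≠ 0 →
      (prodBernoulli w).real (openConn a b) ≤ (prodBernoulli w).real (openConn p b)) :
    (prodBernoulli w).real (⋃ a' ∈ A, openConn o a') - (prodBernoulli w).real (openConn o b) ≤
      1 - (prodBernoulli w).real (openConn a b) := by
  classical
  set U : Set (BondConfig V) := ⋃ a' ∈ A, openConn o a' with hU
  have h := oneLayer_preFKG_of_dominated_inG w A o b a hoA hao hiso hdomG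
  -- `P(U) − P(a ↔ b ∩ U) ≤ P((a ↔ b)ᶜ) = 1 − P(a ↔ b)`
  have hsplit : (prodBernoulli w).real (U ∩ openConn a b) + (prodBernoulli w).real (U \ openConn a b) =
      (prodBernoulli w).real U :=
    measureReal_inter_add_sdiff (s := U) (MeasurableSet.of_discrete : MeasurableSet (openConn a b : Set _))
      (h := measure_ne_top _ _)
  have hcompl : (prodBernoulli w).real (U \ openConn a b) ≤ 1 - (prodBernoulli w).real (openConn a b) := by
    have hc : (prodBernoulli w).real ((openConn a b : Set (BondConfig V))ᶜ) =
        1 - (prodBernoulli w).real (openConn a b) := by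
      rw [measureReal_compl (MeasurableSet.of_discrete), probReal_univ]
    rw [← hc]
    exact measureReal_mono fun ω ⟨_, h2⟩ => h2
  have hmono : (prodBernoulli w).real (openConn o b ∩ U) ≤ (prodBernoulli w).real (openConn o b) :=
    measureReal_mono inter_subset_left
  rw [inter_comm] at hsplit
  linarith

end

end Summit.CriticalPhenomena.PercolationContinuityZ3.Theorems
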